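import Summits.HodgeConjecture.HodgeConjecture.Theses.AmpleAdicLefschetz
import Literature.AlgebraicGeometry.HodgeTheory.HodgeStructureOfHodgeModel
import Literature.AlgebraicGeometry.HodgeTheory.HodgeFiltrationModelsReductionProofs
import Literature.AlgebraicGeometry.Motives.HodgeStructureDirectSum
import Literature.AlgebraicGeometry.HodgeTheory.ComplexConjugationHolds
import Literature.Barriers.HodgeConjecture.GeneralizedHodgeTrivialReasonsProofs

/-!
# Route AmpleAdicLefschetz — `ThickNecessary` (item stmt-HodgeConjecture-2617)

`ThickNecessary := HodgeConjecture → ThickDescent`: THICK (every algebraic class on `Y` lying in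
the image of `f^* : H²ᵖ(X(ℂ); ℂ) → H²ᵖ(Y(ℂ); ℂ)` is `f^*` of an algebraic class of `X`) is a
CONSEQUENCE of the Hodge conjecture.  The printed argument (item docstring; Voisin 2025,
Cor. 2.12; Voisin I, Lemma 7.26 and §7.3.2): write `Alg(Y)_ℂ ∩ im f^*_ℂ = (Alg(Y)_ℚ ∩ im f^*_ℚ) ⊗ ℂ`,
note that rational algebraic classes are Hodge classes, lift each Hodge class of
`im f^*_ℚ ⊆ H²ᵖ(Y(ℂ); ℚ)` to a Hodge class of `H²ᵖ(X(ℂ); ℚ)` by the semisimplicity of polarisable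
`ℚ`-Hodge structures (`f^*` is a morphism of Hodge structures, its image a sub-Hodge structure,
and Hodge classes lift along the surjection onto the image), and apply HC on `X`.

This file proves exactly that, for an ARBITRARY morphism `f : Y ⟶ X` of smooth projective complex
varieties, on the tree's real carriers: the `ℚ`-Hodge structures `HodgeModel.hodgeStructure` of
real Hodge models (`exists_isReal_hodgeModel_holds`), the morphism `HodgeModel.hodgeStructureHom`
underlying `f(ℂ)^*` (`hodgePQ_independent_of_hodgeModel_holds`), Cor. 2.12
(`Motives.HodgeStructure.Hom.exists_mem_hodgeClasses_eq_of_surjective`) and universal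
coefficients (`ofRatClassBaseChange_injective/surjective`, `mem_baseChange_ker_iff`,
`baseChange_map`).  Two classical inputs are NOT yet theorems of the tree and enter as NAMED-FACT
HYPOTHESES (D-0014), making the main result CONDITIONAL on exactly them:

* `Literature.Barriers.HodgeConjecture.Grothendieck1969_supportedClasses_le_hodgeFiltration` —
  Grothendieck 1969, (∗): classes supported in codimension `≥ p` lie in `Fᵖ` (so a RATIONAL
  algebraic class is a Hodge class; "algebraic ⇒ Hodge", Voisin I, Prop. 11.20), used on `Y`;
* the polarisability of the Hodge structures `A.hodgeStructure hY hA k` on `Hᵏ(Y(ℂ); ℚ)` of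
  smooth projective varieties (Hodge–Riemann bilinear relations, Voisin I, Thm. 6.32 with
  Thm. 6.25), used on `X` in degree `2p` for the semisimplicity.  The hypothesis `hpol` is, binder
  for binder, the body of the named fact
  `Literature.AlgebraicGeometry.HodgeTheory.smoothProjective_hodgeStructure_isPolarizable` (file
  `HodgeTheory/HodgeRiemannPolarizability`, the shape `hpol` of `GysinHodgeClassLiftProofs` and
  `HodgeConjectureQbarVoisinProofs`), so that fact discharges it by `exact`; it is spelled out
  rather than imported only because that module had no build on the Lean farm when this file
  landed (2026-08-16).

A second version replaces the polarisability by the INJECTIVITY of `f^*` on `H²ᵖ(X(ℂ); ℂ)` (no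
semisimplicity: for an injective morphism of Hodge structures the preimage of a Hodge class is a
Hodge class, `hom_mem_hodgeClasses_of_injective`), which in the setting of `ThickDescent`
(`2p + |s| ≤ dim X`, `X ∖ f(Y)` covered by the `|s|` affine opens) is the route's own support item
`WeakLefschetzInjective`: `ampleAdicLefschetz_thickNecessary_of_weakLefschetzInjective`.

Main results: `exists_mem_algebraicClasses_map_eq_of_hodgeConjectureFor` (one morphism,
polarisability), `exists_mem_algebraicClasses_map_eq_of_injective` (one morphism, `f^*` injective),
`ampleAdicLefschetz_thickNecessary_of_facts : (∗) → polarisability → ThickNecessary` and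
`ampleAdicLefschetz_thickNecessary_of_weakLefschetzInjective : (∗) → WeakLefschetzInjective →
ThickNecessary`.
-/

-- `Summit.HodgeConjecture.HodgeConjecture.Theorems` is the mandated namespace (single-problem summit:
-- Problem = Summit), which `linter.dupNamespace` flags on every declaration; the lakefile turns the
-- linter off tree-wide (weak option), restated here so stand-alone elaboration is warning-free too.
set_option linter.dupNamespace false

open scoped TensorProduct
open CategoryTheory
open Literature.AlgebraicGeometry Literature.AlgebraicGeometry.HodgeTheory
open Literature.AlgebraicGeometry.Motives Literature.AlgebraicTopology.SingularHomology

namespace Summit.HodgeConjecture.HodgeConjecture.Theorems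

/-! ### Hodge structures: preimages of Hodge classes under injective morphisms -/

section HodgeStructure

universe u v

variable {V : Type u} [AddCommGroup V] [Module ℚ V] {V' : Type v} [AddCommGroup V'] [Module ℚ V']
  {k : ℤ}

/-- **For an injective morphism of Hodge structures the preimage of a Hodge class is a Hodge
class** (the injectivity half of the printed proof of Voisin 2025, Cor. 2.12, without any
polarisation): if `φ : H′ → H` has injective complexification and `φ v` is a Hodge class of `H`
(weight `k = 2p`), write `1 ⊗ v = Σᵢ xᵢ` with `xᵢ ∈ V′^{i,k-i}`; the `φ_ℂ xᵢ ∈ V^{i,k-i}` sum to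
`1 ⊗ φ v ∈ V^{p,p}`, so `φ_ℂ xᵢ = 0` for `i ≠ p` (independence of the Hodge pieces), hence `xᵢ = 0`
and `1 ⊗ v = x_p ∈ Fᵖ`. [cite: Voisin2025, proof of Cor. 2.12] [cite: VoisinHodgeI2002, §7.3.1] -/
theorem hom_mem_hodgeClasses_of_injective {H' : HodgeStructure V' k} {H : HodgeStructure V k}
    (φ : HodgeStructure.Hom H' H) (hinj : Function.Injective (φ.toLinearMap.baseChange ℂ))
    {p : ℤ} (hp : p + p = k) {v : V'} (hv : φ.toLinearMap v ∈ H.hodgeClasses p) :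
    v ∈ H'.hodgeClasses p := by
  set φc := φ.toLinearMap.baseChange ℂ with hφc
  rw [HodgeStructure.mem_hodgeClasses_iff]
  have hX : HodgeStructure.ofRat v ∈ ⨆ i : ℤ, H'.piece i (k - i) := by
    rw [HodgeStructure.iSup_piece_eq_top_holds H']
    exact Submodule.mem_top
  obtain ⟨s, hs⟩ := Submodule.mem_iSup_iff_exists_finset.1 hX
  have hφX : φc (HodgeStructure.ofRat v) ∈ H.piece p (k - p) := by
    rw [hφc, HodgeStructure.baseChange_ofRat, show k - p = p by omega]
    exact HodgeStructure.ofRat_mem_piece_of_mem_hodgeClasses H hp hv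
  suffices key : ∀ (s : Finset ℤ) (x : ℂ ⊗[ℚ] V'), x ∈ ⨆ i ∈ s, H'.piece i (k - i) →
      φc x ∈ H.piece p (k - p) → x ∈ H'.piece p (k - p) from
    HodgeStructure.piece_le_F H' p (k - p) (key s _ hs hφX)
  intro s
  induction s using Finset.induction_on with
  | empty =>
    intro x hx _
    simp only [Finset.notMem_empty, not_false_eq_true, iSup_neg, iSup_bot,
      Submodule.mem_bot] at hx
    rw [hx]
    exact Submodule.zero_mem _
  | insert a s ha ih =>
    intro x hxs hφ
    rw [Finset.iSup_insert, Submodule.mem_sup] at hxs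
    obtain ⟨z, hz, w, hw, rfl⟩ := hxs
    have hφz : φc z ∈ H.piece a (k - a) := φ.map_piece_le _ _ ⟨z, hz, rfl⟩
    have hφw : φc w ∈ ⨆ i ∈ s, H.piece i (k - i) := φ.baseChange_mem_biSup_piece hw
    by_cases hap : a = p
    · subst hap
      have hφw' : φc w ∈ H.piece a (k - a) := by
        have h := Submodule.sub_mem _ hφ hφz
        rwa [map_add, add_sub_cancel_left] at h
      have hw0 : φc w = 0 :=
        (Submodule.disjoint_def.1 (HodgeStructure.disjoint_piece_biSup H ha)) _ hφw' hφw
      have hw0' : w = 0 := hinj (by rw [hw0, map_zero])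
      rw [hw0', add_zero]
      exact hz
    · have hz0 : φc z = 0 := by
        have hdisj : Disjoint (H.piece a (k - a)) (⨆ i ∈ insert p s, H.piece i (k - i)) :=
          HodgeStructure.disjoint_piece_biSup H (by simp [ha, hap])
        refine (Submodule.disjoint_def.1 hdisj) _ hφz ?_
        have h : φc z = φc (z + w) - φc w := by rw [map_add, add_sub_cancel_right]
        rw [h, Finset.iSup_insert]
        exact Submodule.sub_mem _ (Submodule.mem_sup_left hφ) (Submodule.mem_sup_right hφw)
      have hz' : z = 0 := hinj (by rw [hz0, map_zero])
      subst hz'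
      rw [zero_add] at hφ ⊢
      exact ih w hw hφ

end HodgeStructure

/-! ### The carriers: rational algebraic classes, Hodge classes, universal coefficients -/

/-- **Grothendieck's (∗) makes rational algebraic classes Hodge classes.**  Granted
`Grothendieck1969_supportedClasses_le_hodgeFiltration` (`Nᵖ H²ᵖ ⊆ Fᵖ H²ᵖ` in every Hodge model),
for `Y` smooth projective with a Hodge symmetric model `B` and `v ∈ H²ᵖ(Y(ℂ); ℚ)` whose image
`v ⊗ 1 ∈ H²ᵖ(Y(ℂ); ℂ)` is algebraic, `v` is a Hodge class of `B.hodgeStructure` (`Hdgᵖ = V ∩ Fᵖ`).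
[cite: GrothendieckTopology1969, p. 299 (∗)] [cite: VoisinHodgeI2002, §7.1.1 and Prop. 11.20] -/
theorem mem_hodgeClasses_of_ofRatClass_mem_algebraicClasses
    (hF : Literature.Barriers.HodgeConjecture.Grothendieck1969_supportedClasses_le_hodgeFiltration)
    {m p : ℕ} {Y : SchemeOver ℂ} (hY : IsSmoothProjective m Y) (B : HodgeModel m Y)
    (hB : B.IsHodgeSymmetric) {v : singularCohomology ℚ ℚ (ComplexPoints Y) (2 * p)}
    (hv : ofRatClass (ComplexPoints Y) (2 * p) v ∈ algebraicClasses Y p) :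
    v ∈ (B.hodgeStructure hY hB (2 * p)).hodgeClasses p := by
  rw [HodgeStructure.mem_hodgeClasses_iff, HodgeModel.hodgeStructure_F, HodgeModel.mem_ratF_iff,
    HodgeModel.complexification_ofRat, Int.toNat_natCast]
  exact hF m Y hY B (2 * p) p _ hv

/-- **Hodge classes (complexified) are algebraic under the Hodge conjecture for `X`.**  For `X`
smooth projective with a Hodge symmetric model `A`, if every rational `(p, p)`-class of
`H²ᵖ(X(ℂ); ℂ)` is algebraic, then the image under `β_X : ℂ ⊗ H²ᵖ(X(ℂ); ℚ) → H²ᵖ(X(ℂ); ℂ)` of the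
complexification of `Hdgᵖ(A.hodgeStructure)` lies in `algebraicClasses X p` (each `v ⊗ 1`, `v` a
Hodge class, is rational of type `(p, p)`). [cite: Deligne2000, §1] [cite: VoisinHodgeI2002, §7.1.1 and §11.3] -/
theorem map_baseChange_hodgeClasses_le_algebraicClasses {n p : ℕ} {X : SchemeOver ℂ}
    (hX : IsSmoothProjective n X) (A : HodgeModel n X) (hA : A.IsHodgeSymmetric)
    (hHC : ∀ c : complexBetti X (2 * p), IsRationalClass c → IsOfHodgeType n X (2 * p) p p c →
      c ∈ algebraicClasses X p) :
    (((A.hodgeStructure hX hA (2 * p)).hodgeClasses p).baseChange ℂ).map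
        (ofRatClassBaseChange (ComplexPoints X) (2 * p)) ≤ algebraicClasses X p := by
  rw [Submodule.map_le_iff_le_comap, Submodule.baseChange_eq_span, Submodule.span_le]
  rintro _ ⟨v, hv, rfl⟩
  rw [SetLike.mem_coe, Submodule.mem_comap, TensorProduct.mk_apply, ofRatClassBaseChange_tmul,
    one_smul]
  exact hHC _ (isRationalClass_ofRatClass v) (A.isOfHodgeType_of_mem_hodgeClasses hX hA hv)

/-- **Cor. 2.12 for the pull-back `f^*` on `H²ᵖ(–(ℂ); ℚ)`** (Voisin 2025, Cor. 2.12 with Voisin I,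
Lemma 7.26 and §7.3.2): for a morphism `f : Y ⟶ X` of smooth projective varieties with Hodge
symmetric models `A`, `B`, if the Hodge structure `A.hodgeStructure` on `H²ᵖ(X(ℂ); ℚ)` is
polarisable, then every Hodge class of `H²ᵖ(Y(ℂ); ℚ)` of the form `f^* v` is `f^* v'` for a Hodge
class `v'` of `H²ᵖ(X(ℂ); ℚ)` — `f^*` is a morphism of Hodge structures
(`HodgeModel.hodgeStructureHom`), its image is a sub-Hodge structure, and Hodge classes lift along
the surjection onto it (`Hom.exists_mem_hodgeClasses_eq_of_surjective`).
[cite: Voisin2025, Cor. 2.12 and Prop. 2.11] [cite: VoisinHodgeI2002, Lemma 7.26 and §7.3.2] -/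
theorem exists_mem_hodgeClasses_map_eq_of_isPolarizable {n m p : ℕ} {X Y : SchemeOver ℂ}
    (f : Y ⟶ X) (hX : IsSmoothProjective n X) (hY : IsSmoothProjective m Y)
    (A : HodgeModel n X) (hA : A.IsHodgeSymmetric) (B : HodgeModel m Y) (hB : B.IsHodgeSymmetric)
    (hpol : (A.hodgeStructure hX hA (2 * p)).IsPolarizable)
    {v : singularCohomology ℚ ℚ (ComplexPoints X) (2 * p)}
    (hv : (singularCohomology.map ℚ ℚ (AlgPoints.mapContinuous (L := ℂ) f) (2 * p)).hom v ∈
      (B.hodgeStructure hY hB (2 * p)).hodgeClasses p) :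
    ∃ v' ∈ (A.hodgeStructure hX hA (2 * p)).hodgeClasses p,
      (singularCohomology.map ℚ ℚ (AlgPoints.mapContinuous (L := ℂ) f) (2 * p)).hom v' =
        (singularCohomology.map ℚ ℚ (AlgPoints.mapContinuous (L := ℂ) f) (2 * p)).hom v := by
  haveI := finite_singularCohomology_rat_complexPoints hX (2 * p)
  set φ := A.hodgeStructureHom hX hodgePQ_independent_of_hodgeModel_holds hA B hY hB f (2 * p)
    with hφ
  obtain ⟨S, hS⟩ := φ.exists_subHodgeStructure_range
  have hmem : ∀ w, φ.toLinearMap w ∈ S.toSubmodule := fun w ↦ by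
    rw [hS]
    exact LinearMap.mem_range_self _ w
  set ψ := φ.codRestrict S hmem with hψ
  have hsurj : Function.Surjective ψ.toLinearMap := by
    rintro ⟨w, hw⟩
    rw [hS] at hw
    obtain ⟨u, rfl⟩ := hw
    exact ⟨u, rfl⟩
  have hvS : (⟨_, hmem v⟩ : S.toSubmodule) ∈ S.toHodgeStructure.hodgeClasses p :=
    (S.mem_hodgeClasses_iff p _).2 hv
  obtain ⟨v', hv', hψv'⟩ := ψ.exists_mem_hodgeClasses_eq_of_surjective hsurj hpol
    (p := (p : ℤ)) (by push_cast; ring) hvS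
  exact ⟨v', hv', congrArg Subtype.val hψv'⟩

/-- **THICK for one morphism from the Hodge conjecture for `X`, given that Hodge classes of
`H²ᵖ(Y(ℂ); ℚ)` of the form `f^* v` lift to Hodge classes of `H²ᵖ(X(ℂ); ℚ)`** (the common core of
the two versions below).  Let `f : Y ⟶ X` be a morphism of smooth projective varieties with Hodge
symmetric models `A`, `B`, and `c ∈ algebraicClasses Y p` a class in the image of
`f^* : H²ᵖ(X(ℂ); ℂ) → H²ᵖ(Y(ℂ); ℂ)`; grant Grothendieck's (∗), HC for `X` in degree `2p`, and the
lifting property `hlift`.  Then `c = f^* a` with `a ∈ algebraicClasses X p`.  Proof: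
`c = β_Y(f^*_ℂ u)` with `u ∈ ℂ ⊗ H²ᵖ(X(ℂ); ℚ)` (universal coefficients on `X`); `Alg(Y)` is spanned
by its rational classes, which are Hodge classes by (∗), so `f^*_ℂ u ∈ Hdg(Y)_ℂ` (universal
coefficients on `Y`) and `u` lies in the complexification of `(f^*)⁻¹ Hdg(Y)` (`ℂ` flat over `ℚ`);
by `hlift`, `f^*((f^*)⁻¹ Hdg(Y)) ⊆ f^* Hdg(X)`, so `f^*_ℂ u = f^*_ℂ w` with `w ∈ Hdg(X)_ℂ`, and
`a := β_X w` is algebraic by HC on `X`. [cite: Voisin2025, proof of Prop. 3.8]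
[cite: VoisinHodgeI2002, §7.1.1 and Prop. 11.20] [cite: GrothendieckTopology1969, p. 299 (∗)] -/
theorem exists_mem_algebraicClasses_map_eq_of_lift
    (hF : Literature.Barriers.HodgeConjecture.Grothendieck1969_supportedClasses_le_hodgeFiltration)
    {n m p : ℕ} {X Y : SchemeOver ℂ} (f : Y ⟶ X) (hX : IsSmoothProjective n X)
    (hY : IsSmoothProjective m Y) (A : HodgeModel n X) (hA : A.IsHodgeSymmetric)
    (B : HodgeModel m Y) (hB : B.IsHodgeSymmetric)
    (hHC : ∀ c : complexBetti X (2 * p), IsRationalClass c → IsOfHodgeType n X (2 * p) p p c →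
      c ∈ algebraicClasses X p)
    (hlift : ∀ v : singularCohomology ℚ ℚ (ComplexPoints X) (2 * p),
      (singularCohomology.map ℚ ℚ (AlgPoints.mapContinuous (L := ℂ) f) (2 * p)).hom v ∈
          (B.hodgeStructure hY hB (2 * p)).hodgeClasses p →
        ∃ v' ∈ (A.hodgeStructure hX hA (2 * p)).hodgeClasses p,
          (singularCohomology.map ℚ ℚ (AlgPoints.mapContinuous (L := ℂ) f) (2 * p)).hom v' =
            (singularCohomology.map ℚ ℚ (AlgPoints.mapContinuous (L := ℂ) f) (2 * p)).hom v)
    {c : complexBetti Y (2 * p)} (hc : c ∈ algebraicClasses Y p)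
    (hcf : c ∈ LinearMap.range (complexBetti.map f (2 * p)).hom) :
    ∃ a ∈ algebraicClasses X p, complexBetti.map f (2 * p) a = c := by
  set DX := (A.hodgeStructure hX hA (2 * p)).hodgeClasses p with hDX
  set DY := (B.hodgeStructure hY hB (2 * p)).hodgeClasses p with hDY
  set fQ := (singularCohomology.map ℚ ℚ (AlgPoints.mapContinuous (L := ℂ) f) (2 * p)).hom
    with hfQ
  set βX := ofRatClassBaseChange (ComplexPoints X) (2 * p) with hβX
  set βY := ofRatClassBaseChange (ComplexPoints Y) (2 * p) with hβY
  -- `c = f^* (β_X u)`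
  obtain ⟨b, hb⟩ := hcf
  obtain ⟨u, rfl⟩ := ofRatClassBaseChange_surjective hX (2 * p) b
  have hnat : ∀ x, βY (fQ.baseChange ℂ x) = complexBetti.map f (2 * p) (βX x) :=
    fun x ↦ HodgeModel.ofRatClassBaseChange_baseChange_map f (2 * p) x
  -- `Alg(Y) ⊆ β_Y (Hdg(Y)_ℂ)`
  have hAlgY : algebraicClasses Y p ≤ (DY.baseChange ℂ).map βY := by
    refine (supportedClasses_le_span_isRationalClass hY (2 * p) p).trans (Submodule.span_le.2 ?_)
    rintro c' ⟨hr, ha⟩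
    obtain ⟨v, rfl⟩ := (isRationalClass_iff_mem_range_ofRatClass c').1 hr
    refine ⟨HodgeStructure.ofRat v, ?_, ?_⟩
    · rw [HodgeStructure.ofRat_apply]
      exact Submodule.tmul_mem_baseChange_of_mem 1
        (mem_hodgeClasses_of_ofRatClass_mem_algebraicClasses hF hY B hB ha)
    · rw [HodgeStructure.ofRat_apply, hβY, ofRatClassBaseChange_tmul, one_smul]
  -- `f^*_ℂ u ∈ Hdg(Y)_ℂ`
  have h1 : fQ.baseChange ℂ u ∈ DY.baseChange ℂ := by
    have hc' : βY (fQ.baseChange ℂ u) ∈ (DY.baseChange ℂ).map βY := by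
      rw [hnat]
      exact hAlgY (hb ▸ hc)
    obtain ⟨t, ht, hteq⟩ := hc'
    rwa [← ofRatClassBaseChange_injective _ (2 * p) hteq]
  -- `u ∈ ((f^*)⁻¹ Hdg(Y))_ℂ`
  have h2 : u ∈ (DY.comap fQ).baseChange ℂ := by
    have e : DY.comap fQ = LinearMap.ker (DY.mkQ ∘ₗ fQ) := by
      rw [LinearMap.ker_comp, Submodule.ker_mkQ]
    rw [e, HodgeStructure.mem_baseChange_ker_iff, LinearMap.baseChange_comp, LinearMap.comp_apply,
      ← HodgeStructure.mem_baseChange_ker_iff, Submodule.ker_mkQ]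
    exact h1
  -- the lift: `f^* ((f^*)⁻¹ Hdg(Y)) ⊆ f^* Hdg(X)`
  have h3 : (DY.comap fQ).map fQ ≤ DX.map fQ := by
    rintro _ ⟨v, hv, rfl⟩
    obtain ⟨v', hv', he⟩ := hlift v (Submodule.mem_comap.1 hv)
    exact ⟨v', hv', he⟩
  -- `f^*_ℂ u = f^*_ℂ w` with `w ∈ Hdg(X)_ℂ`
  have h4 : fQ.baseChange ℂ u ∈ (DX.map fQ).baseChange ℂ := by
    refine Submodule.baseChange_mono ℂ h3 ?_
    rw [HodgeStructure.baseChange_map]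
    exact Submodule.mem_map_of_mem h2
  rw [HodgeStructure.baseChange_map] at h4
  obtain ⟨w, hw, hweq⟩ := h4
  refine ⟨βX w, map_baseChange_hodgeClasses_le_algebraicClasses hX A hA hHC ⟨w, hw, rfl⟩, ?_⟩
  rw [← hnat, hweq, hnat]
  exact hb

/-- **THICK for one morphism, from the Hodge conjecture for `X`, Grothendieck's (∗) and the
polarisability of `H²ᵖ(X(ℂ); ℚ)`.**  Let `f : Y ⟶ X` be any morphism of smooth projective complex
varieties and `c ∈ algebraicClasses Y p` a class in the image of
`f^* : H²ᵖ(X(ℂ); ℂ) → H²ᵖ(Y(ℂ); ℂ)`.  Granted (∗) (rational algebraic classes of `Y` are Hodge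
classes) and the polarisability of the Hodge structure on `H²ᵖ(X(ℂ); ℚ)` (`hpol`, for the Hodge
symmetric models of `X`; semisimplicity, Cor. 2.12), if every rational `(p, p)`-class of `X` is
algebraic then `c = f^* a` for some
`a ∈ algebraicClasses X p` — `exists_mem_algebraicClasses_map_eq_of_lift` with real Hodge models
(`exists_isReal_hodgeModel_holds`) and the lift `exists_mem_hodgeClasses_map_eq_of_isPolarizable`.
[cite: Voisin2025, Cor. 2.12 and proof of Prop. 3.8] [cite: VoisinHodgeI2002, Lemma 7.26, §7.3.2 and Prop. 11.20]
[cite: GrothendieckTopology1969, p. 299 (∗)] -/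
theorem exists_mem_algebraicClasses_map_eq_of_hodgeConjectureFor
    (hF : Literature.Barriers.HodgeConjecture.Grothendieck1969_supportedClasses_le_hodgeFiltration)
    {n m p : ℕ} {X Y : SchemeOver ℂ} (f : Y ⟶ X) (hX : IsSmoothProjective n X)
    (hY : IsSmoothProjective m Y)
    (hpol : ∀ (A : HodgeModel n X) (hA : A.IsHodgeSymmetric),
      (A.hodgeStructure hX hA (2 * p)).IsPolarizable)
    (hHC : ∀ c : complexBetti X (2 * p), IsRationalClass c → IsOfHodgeType n X (2 * p) p p c →
      c ∈ algebraicClasses X p)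
    {c : complexBetti Y (2 * p)} (hc : c ∈ algebraicClasses Y p)
    (hcf : c ∈ LinearMap.range (complexBetti.map f (2 * p)).hom) :
    ∃ a ∈ algebraicClasses X p, complexBetti.map f (2 * p) a = c := by
  obtain ⟨A, hAr⟩ := exists_isReal_hodgeModel_holds n X hX
  obtain ⟨B, hBr⟩ := exists_isReal_hodgeModel_holds m Y hY
  exact exists_mem_algebraicClasses_map_eq_of_lift hF f hX hY A hAr.isHodgeSymmetric B
    hBr.isHodgeSymmetric hHC (fun v hv ↦ exists_mem_hodgeClasses_map_eq_of_isPolarizable f hX hY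
      A hAr.isHodgeSymmetric B hBr.isHodgeSymmetric (hpol A hAr.isHodgeSymmetric) hv)
    hc hcf

/-- **THICK for one morphism with `f^*` injective on `H²ᵖ(X(ℂ); ℂ)`, from the Hodge conjecture
for `X` and Grothendieck's (∗) only** (no polarisation/semisimplicity): for `v ∈ H²ᵖ(X(ℂ); ℚ)`
with `f^* v` a Hodge class, `v` itself is a Hodge class (`hom_mem_hodgeClasses_of_injective`; the
complexification of `f^*` on rational cohomology is `β_Y⁻¹ ∘ f^*_ℂ ∘ β_X`, injective with `f^*_ℂ`),
so `exists_mem_algebraicClasses_map_eq_of_lift` applies with the identity lift.  This is the form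
THICK takes in the Lefschetz range, where `f^*` is injective by the weak Lefschetz theorem.
[cite: VoisinHodgeI2002, §7.3.1, §7.3.2 and Prop. 11.20] [cite: GrothendieckTopology1969, p. 299 (∗)] -/
theorem exists_mem_algebraicClasses_map_eq_of_injective
    (hF : Literature.Barriers.HodgeConjecture.Grothendieck1969_supportedClasses_le_hodgeFiltration)
    {n m p : ℕ} {X Y : SchemeOver ℂ} (f : Y ⟶ X) (hX : IsSmoothProjective n X)
    (hY : IsSmoothProjective m Y)
    (hHC : ∀ c : complexBetti X (2 * p), IsRationalClass c → IsOfHodgeType n X (2 * p) p p c →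
      c ∈ algebraicClasses X p)
    (hinj : Function.Injective (complexBetti.map f (2 * p)))
    {c : complexBetti Y (2 * p)} (hc : c ∈ algebraicClasses Y p)
    (hcf : c ∈ LinearMap.range (complexBetti.map f (2 * p)).hom) :
    ∃ a ∈ algebraicClasses X p, complexBetti.map f (2 * p) a = c := by
  obtain ⟨A, hAr⟩ := exists_isReal_hodgeModel_holds n X hX
  obtain ⟨B, hBr⟩ := exists_isReal_hodgeModel_holds m Y hY
  have hA := hAr.isHodgeSymmetric
  have hB := hBr.isHodgeSymmetric
  set φ := A.hodgeStructureHom hX hodgePQ_independent_of_hodgeModel_holds hA B hY hB f (2 * p)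
    with hφ
  -- the complexification of `f^*` on `H²ᵖ(–(ℂ); ℚ)` is injective
  have hinjφ : Function.Injective (φ.toLinearMap.baseChange ℂ) := by
    intro x y hxy
    have h := congrArg (ofRatClassBaseChange (ComplexPoints Y) (2 * p)) hxy
    rw [HodgeModel.hodgeStructureHom_toLinearMap, HodgeModel.ofRatClassBaseChange_baseChange_map,
      HodgeModel.ofRatClassBaseChange_baseChange_map] at h
    exact ofRatClassBaseChange_injective _ (2 * p) (hinj h)
  refine exists_mem_algebraicClasses_map_eq_of_lift hF f hX hY A hA B hB hHC (fun v hv ↦ ?_) hc hcf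
  exact ⟨v, hom_mem_hodgeClasses_of_injective φ hinjφ (p := (p : ℤ)) (by push_cast; ring) hv, rfl⟩

/-! ### The item -/

/-- **Item stmt-HodgeConjecture-2617 (`ThickNecessary`), conditional form: THICK is a consequence
of the Hodge conjecture, granted Grothendieck's (∗) and the polarisability of the Hodge structures
of smooth projective varieties** (the two classical inputs not yet proved on the tree's carriers;
named facts, D-0014: `hF` is `Literature.Barriers.HodgeConjecture.Grothendieck1969_supportedClasses_le_hodgeFiltration`
and `hpol` is verbatim the body of
`Literature.AlgebraicGeometry.HodgeTheory.smoothProjective_hodgeStructure_isPolarizable`).  For every closed immersion `f : Y ⟶ X` of smooth projective varieties (in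
fact for every morphism; the affine-cover hypotheses of `ThickDescent` are not used) and every
`c ∈ algebraicClasses Y p` in the image of `f^*`, HC gives `a ∈ algebraicClasses X p` with
`f^* a = c` (`exists_mem_algebraicClasses_map_eq_of_hodgeConjectureFor` with HC for `X`).  The
conclusion is literally the route decl
`Summit.HodgeConjecture.HodgeConjecture.Theses.AmpleAdicLefschetz.ThickNecessary`.
[cite: Voisin2025, Cor. 2.12] [cite: VoisinHodgeI2002, Lemma 7.26 and §7.3.2] [cite: Deligne2000, §1] -/
theorem ampleAdicLefschetz_thickNecessary_of_facts
    (hF : Literature.Barriers.HodgeConjecture.Grothendieck1969_supportedClasses_le_hodgeFiltration)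
    (hpol : ∀ ⦃m : ℕ⦄ ⦃Y : SchemeOver ℂ⦄ (hY : IsSmoothProjective m Y) (A : HodgeModel m Y)
      (hA : A.IsHodgeSymmetric) (k : ℕ), (A.hodgeStructure hY hA k).IsPolarizable) :
    Summit.HodgeConjecture.HodgeConjecture.Theses.AmpleAdicLefschetz.ThickNecessary := by
  unfold Summit.HodgeConjecture.HodgeConjecture.Theses.AmpleAdicLefschetz.ThickNecessary
    Summit.HodgeConjecture.HodgeConjecture.Theses.AmpleAdicLefschetz.ThickDescent
  intro hHC n m p X Y f hX hY _ s _ _ _ c hc hcf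
  exact exists_mem_algebraicClasses_map_eq_of_hodgeConjectureFor hF f hX hY
    (fun A hA ↦ hpol hX A hA (2 * p)) (fun c hc hh ↦ (hHC hX).2 p c hc hh) hc hcf

/-- **Item stmt-HodgeConjecture-2617 (`ThickNecessary`) within the route's own hypotheses: THICK
is a consequence of the Hodge conjecture granted Grothendieck's (∗) and the route's support item
`WeakLefschetzInjective`** (weak Lefschetz, injectivity half, affine-cover form — the hypothesis
`hW` of the deciding theorem `closes`): in the setting of `ThickDescent` (`X ∖ f(Y)` covered by the
`|s|` affine opens of `s`, `2p + |s| ≤ dim X`) `f^*` is injective on `H²ᵖ(X(ℂ); ℂ)`, so the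
polarisation-free `exists_mem_algebraicClasses_map_eq_of_injective` applies with HC for `X`.
[cite: VoisinHodgeII2003, Thm. 1.23] [cite: VoisinHodgeI2002, §7.3.2 and Prop. 11.20]
[cite: GrothendieckTopology1969, p. 299 (∗)] -/
theorem ampleAdicLefschetz_thickNecessary_of_weakLefschetzInjective
    (hF : Literature.Barriers.HodgeConjecture.Grothendieck1969_supportedClasses_le_hodgeFiltration)
    (hW : Summit.HodgeConjecture.HodgeConjecture.Theses.AmpleAdicLefschetz.WeakLefschetzInjective) :
    Summit.HodgeConjecture.HodgeConjecture.Theses.AmpleAdicLefschetz.ThickNecessary := by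
  unfold Summit.HodgeConjecture.HodgeConjecture.Theses.AmpleAdicLefschetz.ThickNecessary
    Summit.HodgeConjecture.HodgeConjecture.Theses.AmpleAdicLefschetz.ThickDescent
  intro hHC n m p X Y f hX hY hf s hs hcov hle c hc hcf
  exact exists_mem_algebraicClasses_map_eq_of_injective hF f hX hY
    (fun c hc hh ↦ (hHC hX).2 p c hc hh) (hW f hX hf s hs hcov (2 * p) hle) hc hcf

end Summit.HodgeConjecture.HodgeConjecture.Theorems
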